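import Literature.AlgebraicGeometry.Resolution.WeightedCentreClassLinearPin
import Literature.AlgebraicGeometry.Resolution.WeightedCentreLayerEquation
import HarnessLib

/-!
# I-RIGID: a pinned weight class carries no infinitesimal translation (instrument, NOT a resolution theorem)

Engine 1 of the RESOLUTION OBSERVATORY toy model `W(f)` (weighted-centre invariant in characteristic `p`) uses three times
(RE-DERIVATION-eng1-g41 §3.4, "LEMMA I-RIGID"; CARVER-NOTES-eng1-g41 T85) and once more as "LEMMA K" of THEOREM F / LEMMA XL
(THEOREM-F-eng1-g40 §4b; CARVER-NOTES-eng1-g40 T78) the following elementary fact about a weighted-homogeneous polynomial `G`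
of weight `μ` over a field of characteristic `p`, a weight class `𝒞 = {j : w j = c}` with `μ < p · c` (non-negative weights), and
a vector `v` supported on `𝒞`:

* `InvariantDirection.isInvariantDir_of_dirDeriv_eq_zero` (I-RIGID core): `∂_v G := Σ_j v_j ∂_j G = 0 ⇒ G(X + t v) = G(X)`
  (`IsInvariantDir G v`).  Proof: `v ≠ 0` is the `V₀`-th column of an invertible CLASS-LINEAR matrix `A`
  (`exists_classLinear_col_eq`); chain rule `∂_{V₀}(G∘A) = (∂_v G)∘A = 0` (`pderiv_linSubst`); `G∘A` is again homogeneous of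
  weight `μ` (`IsClassLinear.isWeightedHomogeneous_linSubst`), so every exponent of `X_{V₀}` in it is `≤ μ/c < p`; the derivative
  criterion `notMem_vars_of_pderiv_eq_zero` (`WeightedCentreLayerEquation`) gives `X_{V₀} ∉ vars (G∘A)`, i.e. (`mem_vars_linSubst_iff`)
  the column `v` is an invariant direction of `G`.
* `InvariantDirection.eq_zero_of_dirDeriv_eq_zero_of_classPinned` (LEMMA K ⇒ hypothesis (K) of LEMMA XL): if moreover every class
  slot is CLASS-PINNED (`ClassPinned 𝒞 G V`, the repaired formal `(P)` of `WeightedCentreClassLinearPin`), then `∂_T G = 0` with `T`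
  supported on `𝒞` forces `T = 0` — the constant class pin map is injective.

In words (engine): "on a face of weight `μ`, a class of weight `c` with `p·c > μ` carries no infinitesimal translation symmetry along a
pinned slot".  No new objects.  Dictionary as in `WeightedCentreInvariantDirection` (`IsInvariantDir`, `linSubst`) and
`WeightedCentreClassLinearPin` (`dirDeriv`, `IsClassLinear`, `ClassPinned`).

References: linear substitutions and the derivative criterion in characteristic `p` [Lang2002, Ch. IV §1, Ch. XIII §4]; the
weighted frame [AbramovichTemkinWlodarczyk2024, §5.1 (p. 1575)].  All statements are OURS (toy-model instruments), not claims of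
the cited sources.
-/

namespace Literature.AlgebraicGeometry.Resolution.WeightedBlowup

namespace InvariantDirection

open MvPolynomial

variable {ι : Type*} [Fintype ι] [DecidableEq ι] {L : Type*} [Field L]

omit [Fintype ι] [DecidableEq ι] in
/-- Exponent bound (bookkeeping, ours): with non-negative weights, `d_i · w_i ≤ weight w d`.
[cite: AbramovichTemkinWlodarczyk2024, §5.1 (p. 1575)] -/
theorem natCast_mul_le_weight {w : ι → ℚ} (hw : ∀ i, 0 ≤ w i) (d : ι →₀ ℕ) (i : ι) :
    (d i : ℚ) * w i ≤ Finsupp.weight w d := by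
  by_cases hi : i ∈ d.support
  · rw [Finsupp.weight_apply, Finsupp.sum]
    have h := Finset.single_le_sum (f := fun j => d j • w j) (fun j _ => nsmul_nonneg (hw j) (d j)) hi
    simpa [nsmul_eq_mul] using h
  · rw [Finsupp.notMem_support_iff.mp hi, Nat.cast_zero, zero_mul, Finsupp.weight_apply, Finsupp.sum]
    exact Finset.sum_nonneg fun j _ => nsmul_nonneg (hw j) (d j)

omit [Fintype ι] [DecidableEq ι] in
/-- Exponent bound along a class slot (ours): if `F` is `w`-homogeneous of weight `μ < p·c` (non-negative weights, `0 < c`) and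
`w V = c`, every exponent of `X_V` in `F` is `< p`. [cite: AbramovichTemkinWlodarczyk2024, §5.1 (p. 1575)] -/
theorem degree_lt_of_isWeightedHomogeneous (p : ℕ) {w : ι → ℚ} (hw : ∀ i, 0 ≤ w i) {c μ : ℚ} (hc : 0 < c) (hμ : μ < p * c)
    {F : MvPolynomial ι L} (hF : IsWeightedHomogeneous w F μ) {V : ι} (hV : w V = c) :
    ∀ d ∈ F.support, d V < p := by
  intro d hd
  have h1 : (d V : ℚ) * c ≤ μ := by
    rw [← hV, ← hF (mem_support_iff.mp hd)]
    exact natCast_mul_le_weight hw d V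
  have h2 : (d V : ℚ) < p := by
    by_contra hge
    rw [not_lt] at hge
    have h3 : (p : ℚ) * c ≤ d V * c := mul_le_mul_of_nonneg_right hge hc.le
    linarith
  exact_mod_cast h2

/-- **I-RIGID core** (ours; engine 1's LEMMA I-RIGID, algebraic heart): for `G` `w`-homogeneous of weight `μ < p·c` in characteristic
`p` (non-negative weights, `0 < c`) and `v` supported on the class `{w = c}`, `∂_v G = 0` implies that `v` is an invariant direction of
`G`: `G(X + t v) = G(X)`. [cite: Lang2002, Ch. IV §1, Ch. XIII §4] -/
theorem isInvariantDir_of_dirDeriv_eq_zero (p : ℕ) [CharP L p] {w : ι → ℚ} (hw : ∀ i, 0 ≤ w i) {c μ : ℚ} (hc : 0 < c)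
    (hμ : μ < p * c) {G : MvPolynomial ι L} (hG : IsWeightedHomogeneous w G μ) (v : ι → L)
    (hv : ∀ j, w j ≠ c → v j = 0) (hD : dirDeriv v G = 0) : IsInvariantDir G v := by
  by_cases hne : v = 0
  · rw [hne]
    exact lineShift_eq_C_of_vars 0 G fun _ _ => rfl
  obtain ⟨V₀, hV₀⟩ := Function.ne_iff.mp hne
  rw [Pi.zero_apply] at hV₀
  have hwV : w V₀ = c := by
    by_contra h
    exact hV₀ (hv V₀ h)
  set S := Finset.univ.filter fun j => w j = c with hS
  have hVS : V₀ ∈ S := by simpa [hS] using hwV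
  obtain ⟨A, A', hAA', hA'A, hcl, hcol⟩ :=
    exists_classLinear_col_eq v hne (fun j hj => hv j (by simpa [hS] using hj)) hVS
  have hu : (fun j => A j V₀) = v := funext hcol
  suffices key : V₀ ∉ (linSubst (fun j k => A j k) G).vars by
    rw [← hu]
    by_contra hni
    exact key ((mem_vars_linSubst_iff (fun j k => A j k) (linSubst_injective_of_mul_eq_one A A' hAA') G V₀).mpr hni)
  have hder : pderiv V₀ (linSubst (fun j k => A j k) G) = 0 := by
    rw [pderiv_linSubst, hu, hD, map_zero]
  have hlin : IsWeightedHomogeneous w (linSubst (fun j k => A j k) G) μ :=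
    hcl.isWeightedHomogeneous_linSubst (fun j hj k hk => by
      simp only [hS, Finset.mem_filter, Finset.mem_univ, true_and] at hj hk
      rw [hj, hk]) hG
  exact notMem_vars_of_pderiv_eq_zero p hder (degree_lt_of_isWeightedHomogeneous p hw hc hμ hlin hwV)

/-- **LEMMA K ⇒ (K)** (ours; the hypothesis of LEMMA XL `WeightedCentreLemmaXL.exists_normalForm`): under the class pin condition
`(P)_class` at every slot of the class `{w = c}` and the weight bound `μ < p·c`, the constant class pin map `T ↦ ∂_T G` of a
`w`-homogeneous `G` of weight `μ` is injective on class vectors. [cite: Lang2002, Ch. IV §1, Ch. XIII §4] -/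
theorem eq_zero_of_dirDeriv_eq_zero_of_classPinned (p : ℕ) [CharP L p] {w : ι → ℚ} (hw : ∀ i, 0 ≤ w i) {c μ : ℚ}
    (hc : 0 < c) (hμ : μ < p * c) {G : MvPolynomial ι L} (hG : IsWeightedHomogeneous w G μ)
    (hPin : ∀ V, w V = c → ClassPinned (Finset.univ.filter fun j => w j = c) G V)
    (T : ι → L) (hT : ∀ j, w j ≠ c → T j = 0) (hD : dirDeriv T G = 0) : T = 0 := by
  by_contra hne
  obtain ⟨V₀, hV₀⟩ := Function.ne_iff.mp hne
  rw [Pi.zero_apply] at hV₀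
  have hwV : w V₀ = c := by
    by_contra h
    exact hV₀ (hT V₀ h)
  have hVS : V₀ ∈ Finset.univ.filter fun j => w j = c := by simpa using hwV
  exact (hPin V₀ hwV).not_isInvariantDir hVS hne (fun j hj => hT j (by simpa using hj))
    (isInvariantDir_of_dirDeriv_eq_zero p hw hc hμ hG T hT hD)

/-- The same with the pin map written out, `Σ_j C T_j · ∂_j G = 0 ⇒ T = 0` (ours; the literal shape of hypothesis `hK` of
`LemmaXL.exists_normalForm`). [cite: Lang2002, Ch. IV §1, Ch. XIII §4] -/
theorem eq_zero_of_sum_C_mul_pderiv_eq_zero_of_classPinned (p : ℕ) [CharP L p] {w : ι → ℚ} (hw : ∀ i, 0 ≤ w i) {c μ : ℚ}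
    (hc : 0 < c) (hμ : μ < p * c) {G : MvPolynomial ι L} (hG : IsWeightedHomogeneous w G μ)
    (hPin : ∀ V, w V = c → ClassPinned (Finset.univ.filter fun j => w j = c) G V)
    (T : ι → L) (hT : ∀ j, w j ≠ c → T j = 0) (hD : ∑ j, C (T j) * pderiv j G = 0) : T = 0 :=
  eq_zero_of_dirDeriv_eq_zero_of_classPinned p hw hc hμ hG hPin T hT hD

end InvariantDirection

end Literature.AlgebraicGeometry.Resolution.WeightedBlowup
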